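import Summits.CriticalPhenomena.SAWScalingLimit.Theses.SAWWeldingIdentification
import Summits.CriticalPhenomena.SAWScalingLimit.Theorems.SAWWeldingIdentificationWeldingContinuityWeld
import Summits.CriticalPhenomena.SAWScalingLimit.Theorems.SAWWeldingIdentificationWeldingContinuityLimit
import Summits.CriticalPhenomena.SAWScalingLimit.Theorems.SAWWeldingIdentificationWeldingContinuityParam
import Literature.Probability.RandomPlanarGeometry.CrossRatioContinuity

/-!
# Welding continuity (route `SAWWeldingIdentification`, item `WeldingContinuity`)

Closing file for item `stmt-CriticalPhenomena-4509`: the support statement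
`Summit.CriticalPhenomena.SAWScalingLimit.Theses.SAWWeldingIdentification.WeldingContinuity` —
**the conformal welding is continuous along simple chords**: if a welding functional `W` is pinned
by the welding equation on every welding configuration of every simple chord of every conformal
rectangle, then `W Q γ_n x → W Q γ x` whenever simple chords `γ_n → γ` (simple) in `CurveClass ℂ`.

Proof (classical; Pommerenke 1992, §2.2–2.3): parametrise the chords injectively with uniformly
convergent parametrisations (part D); the banks of `γ_n` are Jordan domains whose boundary loops
converge uniformly to those of the banks of `γ` (part B); normalise disc charts of the banks at
common interior points and apply **Radó's theorem** (`JordanDomain.rado_tendstoUniformlyOn_holds`):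
the Carathéodory extensions converge uniformly on the closed disc; build welding configurations
from these charts (parts C, C2, F1 — the sign `s = ±1` is the index of `∂Ω`, by the winding
number bookkeeping of part A) and use the pinning hypothesis to write the welding values in disc
coordinates; pass to the limit (part E). The first finitely many chords, whose banks need not
contain the normalisation points, are discarded (`Filter.tendsto_add_atTop_iff_nat`).

References: Ch. Pommerenke, *Boundary Behaviour of Conformal Maps* (1992), Thm. 2.11 (Radó),
Cor. 2.4, Thm. 2.6, Cor. 2.7; T. Radó (1923); S. Sheffield, Ann. Probab. 44 (2016), §1.4.
-/

noncomputable section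

open Set Filter Metric Complex
open scoped Topology
open UpperHalfPlane (upperHalfPlaneSet)
open Literature.Probability.RandomPlanarGeometry Literature.Topology.PlaneTopology

namespace Summit.CriticalPhenomena.SAWScalingLimit.Theorems.WeldingContinuity

/-- Circle preimages of a fixed boundary point under uniformly convergent, eventually injective
charts converge. [folklore] -/
theorem tendsto_circlePreimage {b : ℕ → ℂ} {bl : ℂ} {F : ℕ → ℂ → ℂ} {Fl : ℂ → ℂ}
    (hF : TendstoUniformlyOn F Fl atTop (closedBall 0 1)) (hFlc : ContinuousOn Fl (closedBall 0 1))
    (hFli : InjOn Fl (closedBall 0 1)) {c : ℂ} (hb : ∀ n, b n ∈ sphere (0 : ℂ) 1)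
    (hbl : bl ∈ sphere (0 : ℂ) 1) (hFb : ∀ n, F n (b n) = c) (hFlb : Fl bl = c) :
    Tendsto b atTop (𝓝 bl) := by
  refine tendsto_of_tendstoUniformlyOn_of_injOn (isCompact_closedBall 0 1) hF hFlc hFli
    (fun n => sphere_subset_closedBall (hb n)) (sphere_subset_closedBall hbl) ?_
  rw [hFlb]
  simp only [hFb]
  exact tendsto_const_nhds

/-- Cayley parameters of convergent pairs of distinct circle points converge. [folklore] -/
theorem tendsto_cayleyParam {ζa ζb : ℕ → ℂ} {ζal ζbl : ℂ} (ha : Tendsto ζa atTop (𝓝 ζal))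
    (hb : Tendsto ζb atTop (𝓝 ζbl)) (hbl : ‖ζbl‖ = 1) (hne : ζal ≠ ζbl) :
    Tendsto (fun n => (cayleyInvFun ((ζb n)⁻¹ * ζa n)).re) atTop
      (𝓝 (cayleyInvFun (ζbl⁻¹ * ζal)).re) := by
  have hbl0 : ζbl ≠ 0 := norm_ne_zero_iff.1 (by rw [hbl]; exact one_ne_zero)
  have h1 : Tendsto (fun n => (ζb n)⁻¹ * ζa n) atTop (𝓝 (ζbl⁻¹ * ζal)) := (hb.inv₀ hbl0).mul ha
  have h2 := ((continuousAt_cayleyInvFun (inv_mul_ne_one hbl hne)).tendsto).comp h1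
  exact (continuous_re.tendsto _).comp h2

/-- **Welding continuity, core**: all chords parametrised, banks given with uniformly convergent
loops and common normalisation points `z_L`, `z_R`. [cite: PommerenkeBBCM1992, Thm. 2.11] -/
theorem tendsto_weld_core (W : ConformalRectangle → CurveClass ℂ → ℝ → ℝ)
    (hpin : ∀ (Q : ConformalRectangle) (γ : CurveClass ℂ) (s : ℝ) (L R : Set ℂ)
      (φ : ConformalEquiv upperHalfPlaneSet L) (ψ : ConformalEquiv upperHalfPlaneSet R),
      (γ ∈ CurveClass.simple ∧ γ.source = Q.pt 0 ∧ γ.target = Q.pt 2 ∧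
        γ.range ⊆ closure Q.carrier ∧ γ.range ∩ frontier Q.carrier ⊆ {Q.pt 0, Q.pt 2}) →
      (s = 1 ∨ s = -1) →
      (L ∪ R = Q.carrier \ γ.range ∧ Disjoint L R ∧ IsOpen L ∧ IsOpen R ∧ IsConnected L ∧
        IsConnected R ∧ Q.pt 1 ∈ closure L ∧ Q.pt 3 ∈ closure R) →
      (φ.HasBoundaryValue 0 (Q.pt 0) ∧ φ.HasBoundaryValueAtInfty (Q.pt 2) ∧
        φ.HasBoundaryValue ((s : ℝ) : ℂ) (Q.pt 1) ∧ ψ.HasBoundaryValue 0 (Q.pt 0) ∧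
        ψ.HasBoundaryValueAtInfty (Q.pt 2) ∧ ψ.HasBoundaryValue (-((s : ℝ) : ℂ)) (Q.pt 3)) →
      ∀ x : ℝ, 0 < x → 0 < W Q γ x ∧
        ψ.boundaryExtension (((s * x : ℝ)) : ℂ) = φ.boundaryExtension (((-(s * W Q γ x) : ℝ)) : ℂ))
    (Q : ConformalRectangle) {γ : CurveClass ℂ} {γs : ℕ → CurveClass ℂ}
    (hγ : (Q.chord 0 2 (by decide)).IsSimpleChord γ)
    (hγs : ∀ n, (Q.chord 0 2 (by decide)).IsSimpleChord (γs n))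
    {P : ℝ → ℂ} {Pn : ℕ → ℝ → ℂ}
    (hPc : Continuous P) (hP0 : P 0 = Q.pt 0) (hP1 : P 1 = Q.pt 2) (hPim : P '' Icc 0 1 = γ.range)
    (hPnc : ∀ n, Continuous (Pn n)) (hPn0 : ∀ n, Pn n 0 = Q.pt 0) (hPn1 : ∀ n, Pn n 1 = Q.pt 2)
    (hPnim : ∀ n, Pn n '' Icc 0 1 = (γs n).range)
    {DL DR : JordanDomain}
    (hDLb : DL.boundary = concatPath P (fun u => Q.boundary (Q.mark 2 + u * (Q.mark 0 - Q.mark 2))) ∘ Int.fract)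
    (hDRb : DR.boundary = concatPath P (fun u => Q.boundary (Q.mark 2 + u * (Q.mark 0 + 1 - Q.mark 2))) ∘ Int.fract)
    (hun : DL.carrier ∪ DR.carrier = Q.carrier \ P '' Icc 0 1) (hdj : Disjoint DL.carrier DR.carrier)
    (hfL : frontier DL.carrier = P '' Icc 0 1 ∪ Q.boundary '' Icc (Q.mark 0) (Q.mark 2))
    (hfR : frontier DR.carrier = P '' Icc 0 1 ∪ Q.boundary '' Icc (Q.mark 2) (Q.mark 0 + 1))
    {DLn DRn : ℕ → JordanDomain}
    (hDLnb : ∀ n, (DLn n).boundary =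
      concatPath (Pn n) (fun u => Q.boundary (Q.mark 2 + u * (Q.mark 0 - Q.mark 2))) ∘ Int.fract)
    (hDRnb : ∀ n, (DRn n).boundary =
      concatPath (Pn n) (fun u => Q.boundary (Q.mark 2 + u * (Q.mark 0 + 1 - Q.mark 2))) ∘ Int.fract)
    (hunn : ∀ n, (DLn n).carrier ∪ (DRn n).carrier = Q.carrier \ Pn n '' Icc 0 1)
    (hdjn : ∀ n, Disjoint (DLn n).carrier (DRn n).carrier)
    (hfLn : ∀ n, frontier (DLn n).carrier = Pn n '' Icc 0 1 ∪ Q.boundary '' Icc (Q.mark 0) (Q.mark 2))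
    (hfRn : ∀ n, frontier (DRn n).carrier = Pn n '' Icc 0 1 ∪ Q.boundary '' Icc (Q.mark 2) (Q.mark 0 + 1))
    (hJL : TendstoUniformly (fun n => (DLn n).boundary) DL.boundary atTop)
    (hJR : TendstoUniformly (fun n => (DRn n).boundary) DR.boundary atTop)
    {zL zR : ℂ} (hzL : zL ∈ DL.carrier) (hzR : zR ∈ DR.carrier)
    (hzLn : ∀ n, zL ∈ (DLn n).carrier) (hzRn : ∀ n, zR ∈ (DRn n).carrier) {x : ℝ} (hx : 0 < x) :
    Tendsto (fun n => W Q (γs n) x) atTop (𝓝 (W Q γ x)) := by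
  classical
  -- the sign `s = index of ∂Ω`
  have hzLQ : zL ∈ Q.carrier := (left_subset hun hzL).1
  obtain ⟨s, hs, hsQ⟩ : ∃ s : ℝ, (s = 1 ∨ s = -1) ∧ (Q.index zL : ℝ) = s := by
    rcases Q.toJordanDomain.index_eq_one_or_eq_neg_one hzLQ with h | h
    · exact ⟨1, Or.inl rfl, by rw [h]; simp⟩
    · exact ⟨-1, Or.inr rfl, by rw [h]; simp⟩
  -- normalised disc charts
  obtain ⟨gL, hgL0, hgLre, hgLim⟩ := exists_conformalEquiv_ball_deriv_pos DL.isOpen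
    (JordanDomain.isSimplyConnected_holds DL) DL.carrier_ne_univ hzL
  obtain ⟨gR, hgR0, hgRre, hgRim⟩ := exists_conformalEquiv_ball_deriv_pos DR.isOpen
    (JordanDomain.isSimplyConnected_holds DR) DR.carrier_ne_univ hzR
  choose gLn hgLn0 hgLnre hgLnim using fun n => exists_conformalEquiv_ball_deriv_pos (DLn n).isOpen
    (JordanDomain.isSimplyConnected_holds (DLn n)) (DLn n).carrier_ne_univ (hzLn n)
  choose gRn hgRn0 hgRnre hgRnim using fun n => exists_conformalEquiv_ball_deriv_pos (DRn n).isOpen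
    (JordanDomain.isSimplyConnected_holds (DRn n)) (DRn n).carrier_ne_univ (hzRn n)
  set fL : ConformalEquiv (ball (0 : ℂ) 1) DL.carrier := gL.symm with hfLdef
  set fR : ConformalEquiv (ball (0 : ℂ) 1) DR.carrier := gR.symm with hfRdef
  set fLn : ∀ n, ConformalEquiv (ball (0 : ℂ) 1) (DLn n).carrier := fun n => (gLn n).symm with hfLndef
  set fRn : ∀ n, ConformalEquiv (ball (0 : ℂ) 1) (DRn n).carrier := fun n => (gRn n).symm with hfRndef
  have hf0L : ∀ n, fLn n 0 = fL 0 := fun n => by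
    have h1 := gL.symm_apply_apply hzL
    have h2 := (gLn n).symm_apply_apply (hzLn n)
    rw [hgL0] at h1
    rw [hgLn0 n] at h2
    simp only [hfLndef, hfLdef, h1, h2]
  have hf0R : ∀ n, fRn n 0 = fR 0 := fun n => by
    have h1 := gR.symm_apply_apply hzR
    have h2 := (gRn n).symm_apply_apply (hzRn n)
    rw [hgR0] at h1
    rw [hgRn0 n] at h2
    simp only [hfRndef, hfRdef, h1, h2]
  have hfdL : ∀ n, 0 < (deriv (fLn n) 0).re ∧ (deriv (fLn n) 0).im = 0 := fun n => by
    have h := (gLn n).deriv_symm_mul_deriv (DLn n).isOpen (hzLn n)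
    rw [hgLn0 n] at h
    exact Rado.re_pos_im_zero_of_mul_eq_one (hgLnre n) (hgLnim n) h
  have hfdR : ∀ n, 0 < (deriv (fRn n) 0).re ∧ (deriv (fRn n) 0).im = 0 := fun n => by
    have h := (gRn n).deriv_symm_mul_deriv (DRn n).isOpen (hzRn n)
    rw [hgRn0 n] at h
    exact Rado.re_pos_im_zero_of_mul_eq_one (hgRnre n) (hgRnim n) h
  have hfdLl : 0 < (deriv fL 0).re ∧ (deriv fL 0).im = 0 := by
    have h := gL.deriv_symm_mul_deriv DL.isOpen hzL
    rw [hgL0] at h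
    exact Rado.re_pos_im_zero_of_mul_eq_one hgLre hgLim h
  have hfdRl : 0 < (deriv fR 0).re ∧ (deriv fR 0).im = 0 := by
    have h := gR.deriv_symm_mul_deriv DR.isOpen hzR
    rw [hgR0] at h
    exact Rado.re_pos_im_zero_of_mul_eq_one hgRre hgRim h
  -- Carathéodory extensions and Radó's theorem
  obtain ⟨FL, hFLc, hFLeq, hFLbij, hFLsph⟩ := JordanDomain.exists_continuousOn_extension_holds DL fL
  obtain ⟨FR, hFRc, hFReq, hFRbij, hFRsph⟩ := JordanDomain.exists_continuousOn_extension_holds DR fR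
  choose FLn hFLnc hFLneq hFLnbij hFLnsph using
    fun n => JordanDomain.exists_continuousOn_extension_holds (DLn n) (fLn n)
  choose FRn hFRnc hFRneq hFRnbij hFRnsph using
    fun n => JordanDomain.exists_continuousOn_extension_holds (DRn n) (fRn n)
  have hradoL : TendstoUniformlyOn FLn FL atTop (closedBall (0 : ℂ) 1) :=
    JordanDomain.rado_tendstoUniformlyOn.closedBall JordanDomain.rado_tendstoUniformlyOn_holds
      DLn DL fLn fL hf0L hfdL hfdLl hJL FLn FL hFLnc hFLneq hFLc hFLeq
  have hradoR : TendstoUniformlyOn FRn FR atTop (closedBall (0 : ℂ) 1) :=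
    JordanDomain.rado_tendstoUniformlyOn.closedBall JordanDomain.rado_tendstoUniformlyOn_holds
      DRn DR fRn fR hf0R hfdR hfdRl hJR FRn FR hFRnc hFRneq hFRc hFReq
  -- the welding equations in disc coordinates (limit chord and every chord)
  obtain ⟨ζaL, ζbL, ζcL, ζaR, ζbR, ζcR, uL, uL', uR, uR', hζaL, hζbL, hζcL, hFaL, hFbL, hFcL,
      huL, huL', hvL, hζaR, hζbR, hζcR, hFaR, hFbR, hFcR, huR, huR', hvR, -, hweld⟩ :=
    exists_weldData W hpin Q hγ hPc hP0 hP1 hPim hDLb hDRb hun hdj hfL hfR hzL hzR fL hFLc hFLeq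
      hFLbij.injOn hFLsph fR hFRc hFReq hFRbij.injOn hFRsph hs hsQ hx
  choose ζaLn ζbLn ζcLn ζaRn ζbRn ζcRn uLn uLn' uRn uRn' hζaLn hζbLn hζcLn hFaLn hFbLn hFcLn
      huLn huLn' hvLn hζaRn hζbRn hζcRn hFaRn hFbRn hFcRn huRn huRn' hvRn hposn hweldn using
    fun n => exists_weldData W hpin Q (hγs n) (hPnc n) (hPn0 n) (hPn1 n) (hPnim n) (hDLnb n)
      (hDRnb n) (hunn n) (hdjn n) (hfLn n) (hfRn n) (hzLn n) (hzRn n) (fLn n) (hFLnc n)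
      (hFLneq n) (hFLnbij n).injOn (hFLnsph n) (fRn n) (hFRnc n) (hFRneq n) (hFRnbij n).injOn
      (hFRnsph n) hs hsQ hx
  -- the circle points converge
  have hζaL' : Tendsto ζaLn atTop (𝓝 ζaL) :=
    tendsto_circlePreimage hradoL hFLc hFLbij.injOn hζaLn hζaL hFaLn hFaL
  have hζbL' : Tendsto ζbLn atTop (𝓝 ζbL) :=
    tendsto_circlePreimage hradoL hFLc hFLbij.injOn hζbLn hζbL hFbLn hFbL
  have hζcL' : Tendsto ζcLn atTop (𝓝 ζcL) :=
    tendsto_circlePreimage hradoL hFLc hFLbij.injOn hζcLn hζcL hFcLn hFcL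
  have hζaR' : Tendsto ζaRn atTop (𝓝 ζaR) :=
    tendsto_circlePreimage hradoR hFRc hFRbij.injOn hζaRn hζaR hFaRn hFaR
  have hζbR' : Tendsto ζbRn atTop (𝓝 ζbR) :=
    tendsto_circlePreimage hradoR hFRc hFRbij.injOn hζbRn hζbR hFbRn hFbR
  have hζcR' : Tendsto ζcRn atTop (𝓝 ζcR) :=
    tendsto_circlePreimage hradoR hFRc hFRbij.injOn hζcRn hζcR hFcRn hFcR
  -- the Cayley parameters converge
  have h02 : Q.pt 0 ≠ Q.pt 2 := fun h => absurd (Q.pt_injective h) (by decide)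
  have h12 : Q.pt 1 ≠ Q.pt 2 := fun h => absurd (Q.pt_injective h) (by decide)
  have h32 : Q.pt 3 ≠ Q.pt 2 := fun h => absurd (Q.pt_injective h) (by decide)
  have habL : ζaL ≠ ζbL := fun h => h02 (by rw [← hFaL, ← hFbL, h])
  have hcbL : ζcL ≠ ζbL := fun h => h12 (by rw [← hFcL, ← hFbL, h])
  have habR : ζaR ≠ ζbR := fun h => h02 (by rw [← hFaR, ← hFbR, h])
  have hcbR : ζcR ≠ ζbR := fun h => h32 (by rw [← hFcR, ← hFbR, h])
  have hζbL1 : ‖ζbL‖ = 1 := mem_sphere_zero_iff_norm.1 hζbL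
  have hζbR1 : ‖ζbR‖ = 1 := mem_sphere_zero_iff_norm.1 hζbR
  have huLlim : Tendsto uLn atTop (𝓝 uL) := by
    rw [show uLn = fun n => (cayleyInvFun ((ζbLn n)⁻¹ * ζaLn n)).re from funext huLn, huL]
    exact tendsto_cayleyParam hζaL' hζbL' hζbL1 habL
  have huL'lim : Tendsto uLn' atTop (𝓝 uL') := by
    rw [show uLn' = fun n => (cayleyInvFun ((ζbLn n)⁻¹ * ζcLn n)).re from funext huLn', huL']
    exact tendsto_cayleyParam hζcL' hζbL' hζbL1 hcbL
  have huRlim : Tendsto uRn atTop (𝓝 uR) := by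
    rw [show uRn = fun n => (cayleyInvFun ((ζbRn n)⁻¹ * ζaRn n)).re from funext huRn, huR]
    exact tendsto_cayleyParam hζaR' hζbR' hζbR1 habR
  have huR'lim : Tendsto uRn' atTop (𝓝 uR') := by
    rw [show uRn' = fun n => (cayleyInvFun ((ζbRn n)⁻¹ * ζcRn n)).re from funext huRn', huR']
    exact tendsto_cayleyParam hζcR' hζbR' hζbR1 hcbR
  have hcL : Tendsto (fun n => |uLn' n - uLn n|) atTop (𝓝 |uL' - uL|) :=
    (continuous_abs.tendsto _).comp (huL'lim.sub huLlim)
  have hcR : Tendsto (fun n => |uRn' n - uRn n|) atTop (𝓝 |uR' - uR|) :=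
    (continuous_abs.tendsto _).comp (huR'lim.sub huRlim)
  -- pass to the limit in the welding equation (part E)
  exact tendsto_weldValue hFLc hFLbij.injOn hFRc hradoL hradoR
    (fun n => mem_sphere_zero_iff_norm.1 (hζbLn n)) hζbL1
    (fun n => mem_sphere_zero_iff_norm.1 (hζbRn n)) hζbR1 hζbL' hζbR' (abs_ne_zero.2 hvL)
    huLlim hcL huRlim hcR hs hweldn hweld

/-- **Welding continuity** (item `stmt-CriticalPhenomena-4509` of route
`SAWWeldingIdentification`): the conformal welding is continuous along simple chords converging
to a simple chord. [cite: PommerenkeBBCM1992, Thm. 2.11] -/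
theorem weldingContinuity_proof :
    Summit.CriticalPhenomena.SAWScalingLimit.Theses.SAWWeldingIdentification.WeldingContinuity := by
  intro W hpin Q γs γ hγs hγ hconv x hx
  classical
  -- injective, uniformly convergent parametrisations
  obtain ⟨p, q, hp, hq, rfl, hqeq, hdist⟩ := exists_isSimple_params (fun n => (hγs n).1) hγ.1 hconv
  have hγ' : (Q.chord 0 2 (by decide)).IsSimpleChord (CurveClass.mk p) := hγ
  have hγs' : ∀ n, (Q.chord 0 2 (by decide)).IsSimpleChord (CurveClass.mk (q n)) := fun n => by
    rw [hqeq n]; exact hγs n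
  set P : ℝ → ℂ := IccExtend zero_le_one (p : unitInterval → ℂ) with hPdef
  set Pn : ℕ → ℝ → ℂ := fun n => IccExtend zero_le_one (q n : unitInterval → ℂ) with hPndef
  have hPc : Continuous P := continuous_chordParam p
  have hPi : InjOn P (Icc 0 1) := injOn_chordParam hp
  have hP0 : P 0 = Q.pt 0 := chordParam_zero_eq_pt hγ'
  have hP1 : P 1 = Q.pt 2 := chordParam_one_eq_pt hγ'
  have hPΩ : ∀ t ∈ Ioo (0 : ℝ) 1, P t ∈ Q.carrier := fun t ht => chordParam_mem_carrier hp hγ' ht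
  have hPim : P '' Icc 0 1 = (CurveClass.mk p).range := image_chordParam p
  have hPnc : ∀ n, Continuous (Pn n) := fun n => continuous_chordParam (q n)
  have hPni : ∀ n, InjOn (Pn n) (Icc 0 1) := fun n => injOn_chordParam (hq n)
  have hPn0 : ∀ n, Pn n 0 = Q.pt 0 := fun n => chordParam_zero_eq_pt (hγs' n)
  have hPn1 : ∀ n, Pn n 1 = Q.pt 2 := fun n => chordParam_one_eq_pt (hγs' n)
  have hPnΩ : ∀ n, ∀ t ∈ Ioo (0 : ℝ) 1, Pn n t ∈ Q.carrier := fun n t ht =>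
    chordParam_mem_carrier (hq n) (hγs' n) ht
  have hPnim : ∀ n, Pn n '' Icc 0 1 = (γs n).range := fun n => by
    rw [← hqeq n]; exact image_chordParam (q n)
  -- banks
  obtain ⟨DL, DR, hDLb, hDRb, hun, hdj, hfL, hfR⟩ := exists_banks Q hPc hPi hP0 hP1 hPΩ
  choose DLn DRn hDLnb hDRnb hunn hdjn hfLn hfRn using
    fun n => exists_banks Q (hPnc n) (hPni n) (hPn0 n) (hPn1 n) (hPnΩ n)
  -- the bank loops converge uniformly
  have hU : TendstoUniformly Pn P atTop := tendstoUniformly_IccExtend hdist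
  have hJL : TendstoUniformly (fun n => (DLn n).boundary) DL.boundary atTop := by
    rw [show (fun n => (DLn n).boundary) = fun n => concatPath (Pn n)
        (fun u => Q.boundary (Q.mark 2 + u * (Q.mark 0 - Q.mark 2))) ∘ Int.fract from funext hDLnb,
      hDLb]
    exact tendstoUniformly_concatPath_fract _ hU
  have hJR : TendstoUniformly (fun n => (DRn n).boundary) DR.boundary atTop := by
    rw [show (fun n => (DRn n).boundary) = fun n => concatPath (Pn n)
        (fun u => Q.boundary (Q.mark 2 + u * (Q.mark 0 + 1 - Q.mark 2))) ∘ Int.fract from funext hDRnb,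
      hDRb]
    exact tendstoUniformly_concatPath_fract _ hU
  -- common normalisation points, for all but finitely many chords
  obtain ⟨zL, hzL⟩ := DL.nonempty
  obtain ⟨zR, hzR⟩ := DR.nonempty
  obtain ⟨N₀, hN₀⟩ := eventually_atTop.1
    ((JordanDomain.eventually_mem_carrier_of_tendstoUniformly (D := DLn) hJL hzL).and
      (JordanDomain.eventually_mem_carrier_of_tendstoUniformly (D := DRn) hJR hzR))
  have hJL' : TendstoUniformly (fun n => (DLn (n + N₀)).boundary) DL.boundary atTop := by
    rw [Metric.tendstoUniformly_iff] at hJL ⊢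
    exact fun ε hε => (tendsto_add_atTop_nat N₀).eventually (hJL ε hε)
  have hJR' : TendstoUniformly (fun n => (DRn (n + N₀)).boundary) DR.boundary atTop := by
    rw [Metric.tendstoUniformly_iff] at hJR ⊢
    exact fun ε hε => (tendsto_add_atTop_nat N₀).eventually (hJR ε hε)
  have h := tendsto_weld_core W hpin Q hγ' (fun n => hγs (n + N₀)) hPc hP0 hP1 hPim
    (fun n => hPnc (n + N₀)) (fun n => hPn0 (n + N₀)) (fun n => hPn1 (n + N₀))
    (fun n => hPnim (n + N₀)) hDLb hDRb hun hdj hfL hfR (fun n => hDLnb (n + N₀))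
    (fun n => hDRnb (n + N₀)) (fun n => hunn (n + N₀)) (fun n => hdjn (n + N₀))
    (fun n => hfLn (n + N₀)) (fun n => hfRn (n + N₀)) hJL' hJR' hzL hzR
    (fun n => (hN₀ (n + N₀) (Nat.le_add_left _ _)).1)
    (fun n => (hN₀ (n + N₀) (Nat.le_add_left _ _)).2) hx
  exact (tendsto_add_atTop_iff_nat N₀).1 h

end Summit.CriticalPhenomena.SAWScalingLimit.Theorems.WeldingContinuity

end
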